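import Summits.QuantumFields.YangMills.Theorems.AtomicCalibrationRGridPartition
import Summits.QuantumFields.YangMills.Theorems.AtomicCalibrationRWhitneyBookkeeping

/-!
# AtomicCalibrationR (stmt-QuantumFields-28169), E2 `stub_offDiagonalWhitney` — clauses (ii)–(iv) of `WhitneyPkg` for grid pieces
# (construction (T) of the E2 helper note, evidence #19 on 28169; prover w4 g22, free hands)

For a piece supported in the grid cube `(h, c)` (`AtomicCalibrationRGridPartition`: every slot within `ρ := 2h` of `gridCentre n h c`)
that only lives where all slot pairs are `≥ d` apart (the telescoping cut-off factor, `AtomicCalibrationRPairCutoffProduct`: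
`d = 2^{−(k+1)}` at level `k+1`, `d = 1` at the far level), the Whitney separation clause (iv) holds with radius `ρ = 2h` as soon as
`4(Λ+1) h ≤ d`:

* `exists_coord_sep_gridCentre` — `∀ l ≠ l', ∃ i, Λ · (2h) ≤ |centre_l i − centre_{l'} i|`;
* `radius_le_half` — clause (ii) `0 < 2h ≤ 1/2` under `4(Λ+1)h ≤ d ≤ 1`, `Λ ≥ 1`;
* `tsupport_piece_subset` — clause (iii) for any piece of the form `G · gridBump` (support of a product sits in the cube).

No stub/crux/rung/summit is closed; nothing here touches Yang–Mills; the YM mass gap is NOT proved. [folklore]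
-/

set_option autoImplicit false

noncomputable section

open Set
open Summit.QuantumFields.YangMills.Cruxes.AtomicCalibrationR.GridPartition (gridBump gridCentre
  norm_sub_gridCentre_le_of_gridBump_ne_zero tsupport_gridBump_subset)
open Summit.QuantumFields.YangMills.Cruxes.AtomicCalibrationR.WhitneyBookkeeping (exists_coord_sep)

namespace Summit.QuantumFields.YangMills.Cruxes.AtomicCalibrationR.WhitneySeparation

variable {n : ℕ}

/-- **Clause (iv) for grid pieces.**  If the bump of the cube `(h, c)` is alive at a point `z` all of whose slot pairs are `≥ d`
apart, and `4(Λ+1)h ≤ d`, then every pair of slot centres is `Λ·(2h)`-separated in some coordinate. -/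
theorem exists_coord_sep_gridCentre {φ : ℝ → ℝ} (hφs : tsupport φ ⊆ Icc (-1 : ℝ) 1) {h : ℝ} (hh : 0 < h)
    {c : Fin n × Fin 4 → ℤ} {z : Fin n → EuclideanSpace ℝ (Fin 4)} (hz : gridBump φ n h c z ≠ 0) {d Λ : ℝ}
    (hd : ∀ l l' : Fin n, l ≠ l' → d ≤ ‖z l - z l'‖) (hhd : 4 * (Λ + 1) * h ≤ d) {l l' : Fin n} (hll' : l ≠ l') :
    ∃ i : Fin 4, Λ * (2 * h) ≤ |gridCentre n h c l i - gridCentre n h c l' i| := by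
  have hρ : ∀ m : Fin n, ‖z m - gridCentre n h c m‖ ≤ 2 * h := fun m => norm_sub_gridCentre_le_of_gridBump_ne_zero hφs hh hz m
  obtain ⟨i, hi⟩ := exists_coord_sep z (gridCentre n h c) hρ (hd l l' hll')
  refine ⟨i, le_trans ?_ hi⟩
  -- `Λ·2h ≤ (d − 4h)/2` from `4(Λ+1)h ≤ d`
  nlinarith

/-- **Clause (ii)**: `0 < 2h ≤ 1/2` whenever `4(Λ+1)h ≤ d ≤ 1` (and `Λ ≥ 0`). -/
theorem radius_le_half {h d Λ : ℝ} (hh : 0 < h) (hΛ : 0 ≤ Λ) (hhd : 4 * (Λ + 1) * h ≤ d) (hd1 : d ≤ 1) :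
    0 < 2 * h ∧ 2 * h ≤ 1 / 2 := by
  constructor
  · linarith
  · nlinarith

/-- **Clause (iii)** for pieces `G · gridBump`: the support sits in the cube, `‖z_l − centre_l‖ ≤ 2h` for all slots. -/
theorem tsupport_piece_subset {φ : ℝ → ℝ} (hφs : tsupport φ ⊆ Icc (-1 : ℝ) 1) {h : ℝ} (hh : 0 < h)
    (c : Fin n × Fin 4 → ℤ) (G : (Fin n → EuclideanSpace ℝ (Fin 4)) → ℝ) :
    tsupport (fun z => G z * gridBump φ n h c z) ⊆ {z | ∀ l, ‖z l - gridCentre n h c l‖ ≤ 2 * h} :=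
  (tsupport_mul_subset_right (f := G) (g := gridBump φ n h c)).trans (tsupport_gridBump_subset hφs n hh c)

/-- The piece `G · gridBump` has compact support (so `HasCompactSupport.toSchwartzMap` applies once it is smooth). -/
theorem hasCompactSupport_piece {φ : ℝ → ℝ} (hφs : tsupport φ ⊆ Icc (-1 : ℝ) 1) {h : ℝ} (hh : 0 < h)
    (c : Fin n × Fin 4 → ℤ) (G : (Fin n → EuclideanSpace ℝ (Fin 4)) → ℝ) :
    HasCompactSupport (fun z => G z * gridBump φ n h c z) :=
  (Summit.QuantumFields.YangMills.Cruxes.AtomicCalibrationR.GridPartition.hasCompactSupport_gridBump hφs n hh c).mul_left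

end Summit.QuantumFields.YangMills.Cruxes.AtomicCalibrationR.WhitneySeparation

end
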